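/-
Copyright: the b2b-balaban cell (near-miss cell 7), T⁴-continuum fan-out, NE7b ROUND-2 swarm `t4-ne7b-formalise-*`
(seat leaf-07, gen 2), row S6 pt 3b∕3c «zones of realised histories» AT LEVELS (owner's ruling R-OWNER-22-15) of
lineage t4-ne7b-p1's claim table `LEAVES-NE7b.md`.  Part 3b-II: the walk along `Realises`.
Released under the licence of the surrounding project.
-/
import Summits.QuantumFields.BalabanUV.T4Continuum.Support.HistoryZonesOrbit
import Summits.QuantumFields.BalabanUV.T4Continuum.Support.SpaceTimeJunction
import Summits.QuantumFields.BalabanUV.T4Continuum.Support.HistoryZoneMass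

/-!
# History zones from orbits, II: a REALISED history inhabits the levelled tolerant reading (regions + contact)

Summits-side support leaf of the T⁴-continuum cell (rung (B)+1 on a FINITE torus only; NOT infinite volume, NOT the
mass gap, NOT the Clay statement; NOT a proof of the spine estimate NE7b).  Row S6 pt 3b∕3c (R-OWNER-22-15, «GO
leaf-07 g2»): the last zone-side supplier of the A12-I.Z twin.  A tagged genealogy `G : Gen ε` (shape map `sh`,
payload map `pay : ε → Pt d × Finset (Pt d)` = (anchor, region) of a birth label) that CORRESPONDS node by node
(`Corr`) to a census history `P : PGen (Pt d × Finset (Pt d))` REALISED by leaf-08's blocked dynamics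
(`HistoryRealise.Realises L s R P Z`) satisfies the birth-region laws AT LEVELS of `HistoryZonesDropsRegions`
(`BirthRegionsD sh n L K (levelOf s K) (4·2^d) 32 G reg`, `reg b := redZone (n·L^{K − lv (sh b).step}) (pay b).2`): the
regions are the reduced birth regions, and CONTACT at every merge node follows from `Touch` of the partners' S-image
orbits — because every sub-history's orbit, reduced to the torus of its level, lies in the `31`-thickened levelled
zone of the corresponding sub-structure (part I, `redZone_orbit_subset`), and touching cubes are `1` apart.  [folklore]
bookkeeping∕finite geometry on the lineage's OWN index model; nothing is quoted from print, nothing printed is asserted,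
no `[cite:]` tag, no `Prop` fact minted (`Corr` is a node-wise correspondence predicate between two of OUR carriers).

WHAT.  §1 **`Corr sh pay G P`** (same tree; birth labels of shape `(j, 0, cls)` with payload = the node's `(anchor,
region)`; renewal labels `(h+1, 1, 0)`; merger labels `(s, 2, 0)`), `regR`, and the facts read off a realised
correspondence: `births_facts_of_corr` (anchor ∈ region, face-connected, `treeLen ≤ class`, kind `0`), `leafStep_of_corr`,
`events_step_le_of_corr`.  §2 **`redZone_orbit_subset_regZoneD`**: for `Corr G P`, `Realises L s R P Z`,
`P.lastStep ≤ t ≤ K`: `redZone (n·L^{K − lv t}) (orbit L s P.lastStep Z (t − P.lastStep)) ⊆ regZoneD sh n L K lv 31 regR t G`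
(induction along `Realises`: birth = part I; renewal = `orbit_add`; join = `Z ⊆ orbit X ∪ orbit Y`,
`SpaceTimePeierls.Siter_mono`, `B16MergeGeometry.Siter_union`).  §3 **`contact_of_corr`**: at every merge node of `G` the
partners' `32`-zones share a cell (the reduced touching cube).  **`birthRegionsD_of_corr`** (`Cb = 4·2^d`, `c = 32`).  §4 sanity.  Part 3b-III (`HistoryZonesOrbitPlace.lean`): the
realised placement `placeD` and the consumers `admZ_of_corr_realises` ∕ `card_admZSet_le_of_corr_realises`; part 3c
(`HistoryZonesOrbitPedigree.lean`): `Corr Prod.fst _ (genT c) (toPGen cellP c)` for leaf-09's pedigrees, and the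
instance over leaf-08 g2's `RealisedDomains`.

HONEST DEPENDENCY (cell): continuum YM on T⁴ ⇐ BetaPertH ∧ nine spine estimates (0/9 proved); BetaPertH ⇐ (D1) ∧ (D4)
∧ CAP+tail; G-an2-4 gates asym, D1 and NE2/3/4.  This file changes none of it.  NE7b NOT proved.
-/

open Finset
open Literature.MathematicalPhysics.QuantumFieldTheory.Balaban1983to89
open Literature.MathematicalPhysics.QuantumFieldTheory.Balaban1983to89.B13ScaleTransfer
open Literature.MathematicalPhysics.QuantumFieldTheory.Balaban1983to89.TreeLength
open Literature.MathematicalPhysics.QuantumFieldTheory.Balaban1983to89.B16SProfile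
open Literature.MathematicalPhysics.QuantumFieldTheory.Balaban1983to89.B16MergeGeometry
open T4PersistenceDictionary T4PartnerMultiplicity
open Summit.QuantumFields.BalabanUV.T4Continuum.PlacementSkeleton
open Summit.QuantumFields.BalabanUV.T4Continuum.Crowding
open Summit.QuantumFields.BalabanUV.T4Continuum.ZoneSkeleton
open Summit.QuantumFields.BalabanUV.T4Continuum.ZoneCrowd
open Summit.QuantumFields.BalabanUV.T4Continuum.ZoneTorus
open Summit.QuantumFields.BalabanUV.T4Continuum.HistoryAdmissible
open Summit.QuantumFields.BalabanUV.T4Continuum.HistoryRealise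
open Summit.QuantumFields.BalabanUV.T4Continuum.HistoryRealiseCells

namespace Summit.QuantumFields.BalabanUV.T4Continuum.HistoryZones

noncomputable section

variable {d : ℕ} {ε : Type*} [DecidableEq ε] (sh : ε → PEv) (pay : ε → Pt d × Finset (Pt d))

/-! ## §1 The correspondence between a tagged genealogy and a realised census history -/

/-- **NODE-WISE CORRESPONDENCE** between a tagged genealogy and a census history with `(anchor, region)` payloads: the
same tree; a birth label has shape `(j, 0, cls)` and payload the node's `(anchor, region)`; a renewal label has shape
`(h+1, 1, 0)` (readiness `h`); a merger label has shape `(s, 2, 0)`. [folklore] -/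
def Corr : Gen ε → PGen (Pt d × Finset (Pt d)) → Prop
  | Gen.born b j, PGen.birth j' cls zZ => j = j' ∧ sh b = ((j', 0, cls) : PEv) ∧ pay b = zZ
  | Gen.renew G e h, PGen.renew P h' => h = h' ∧ sh e = ((h' + 1, 1, 0) : PEv) ∧ Corr G P
  | Gen.merge X Y e, PGen.join A B s => sh e = ((s, 2, 0) : PEv) ∧ Corr X A ∧ Corr Y B
  | Gen.born _ _, PGen.renew _ _ => False
  | Gen.born _ _, PGen.join _ _ _ => False
  | Gen.renew _ _ _, PGen.birth _ _ _ => False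
  | Gen.renew _ _ _, PGen.join _ _ _ => False
  | Gen.merge _ _ _, PGen.birth _ _ _ => False
  | Gen.merge _ _ _, PGen.renew _ _ => False

/-- THE REGION MAP AT LEVELS read off the payloads: the reduced region of a birth label on the torus of the level of its
shape-step. [folklore] -/
def regR (n L K : ℕ) (lv : ℕ → ℕ) (b : ε) : Finset (Fin d → ℕ) :=
  redZone (n * L ^ (K - lv (sh b).step)) (pay b).2

variable {sh pay}

/-- in a realised history every sub-history's last step is at most the whole's [folklore] -/
theorem lastStep_realises_le {L : ℕ} {s R : ℕ → ℕ} :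
    ∀ (P : PGen (Pt d × Finset (Pt d))) (Z : Finset (Pt d)), Realises L s R P Z → P.rootStep ≤ P.lastStep
  | .birth j cls zZ, Z, _ => le_rfl
  | .renew G h, Z, hR => by
      obtain ⟨ZG, hG, hst, -, -⟩ := hR
      have := hst.pos
      have := lastStep_realises_le G ZG hG
      simp only [PGen.rootStep, PGen.lastStep]
      omega
  | .join A B sj, Z, hR => by
      obtain ⟨ZA, ZB, hA, hB, htA, htB, -, -, -, -⟩ := hR
      have := lastStep_realises_le A ZA hA
      have := lastStep_realises_le B ZB hB
      simp only [PGen.rootStep, PGen.lastStep]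
      omega

/-- **THE BIRTH FACTS READ OFF A REALISED CORRESPONDENCE**: every birth label of `G` has kind `0`, its anchor lies in
its region, the region is face-connected and its tree length is at most the label's class. [folklore] -/
theorem births_facts_of_corr {L : ℕ} {s R : ℕ → ℕ} :
    ∀ (P : PGen (Pt d × Finset (Pt d))) (G : Gen ε) (Z : Finset (Pt d)), Corr sh pay G P → Realises L s R P Z →
      ∀ b ∈ births G, (sh b).kind = 0 ∧ (pay b).1 ∈ (pay b).2 ∧ FaceConnected (pay b).2 ∧
        treeLen (pay b).2 ≤ (sh b).fat
  | .birth j cls zZ, Gen.born b' j', Z, hc, hR, b, hb => by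
      obtain ⟨-, hsh, hpay⟩ := hc
      obtain ⟨hZ, hz, hfc, hlen⟩ := hR
      rw [births_born, mem_singleton] at hb
      subst hb
      rw [hsh, hpay, hZ]
      exact ⟨rfl, hz, hfc, by simpa using hlen⟩
  | .birth _ _ _, Gen.renew _ _ _, _, hc, _, _, _ => hc.elim
  | .birth _ _ _, Gen.merge _ _ _, _, hc, _, _, _ => hc.elim
  | .renew P h, Gen.renew G e h', Z, hc, hR, b, hb => by
      obtain ⟨-, -, hc'⟩ := hc
      obtain ⟨ZG, hG, -, -, -⟩ := hR
      exact births_facts_of_corr P G ZG hc' hG b (by simpa using hb)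
  | .renew _ _, Gen.born _ _, _, hc, _, _, _ => hc.elim
  | .renew _ _, Gen.merge _ _ _, _, hc, _, _, _ => hc.elim
  | .join A B sj, Gen.merge X Y e, Z, hc, hR, b, hb => by
      obtain ⟨-, hcX, hcY⟩ := hc
      obtain ⟨ZA, ZB, hA, hB, -, -, -, -, -, -⟩ := hR
      rw [births_merge, mem_union] at hb
      rcases hb with hb | hb
      · exact births_facts_of_corr A X ZA hcX hA b hb
      · exact births_facts_of_corr B Y ZB hcY hB b hb
  | .join _ _ _, Gen.born _ _, _, hc, _, _, _ => hc.elim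
  | .join _ _ _, Gen.renew _ _ _, _, hc, _, _, _ => hc.elim

omit [DecidableEq ε] in
/-- **LEAF STEPS**: in a correspondence every leaf `born b j` of `G` has `(sh b).step = j`. [folklore] -/
theorem leafStep_of_corr :
    ∀ (P : PGen (Pt d × Finset (Pt d))) (G : Gen ε), Corr sh pay G P →
      ∀ (b : ε) (j : ℕ), Sub (Gen.born b j) G → (sh b).step = j
  | .birth j cls zZ, Gen.born b' j', hc, b, j₀, hs => by
      obtain ⟨hjj, hsh, -⟩ := hc
      cases hs
      rw [hsh]
      exact hjj.symm
  | .birth _ _ _, Gen.renew _ _ _, hc, _, _, _ => hc.elim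
  | .birth _ _ _, Gen.merge _ _ _, hc, _, _, _ => hc.elim
  | .renew P h, Gen.renew G e h', hc, b, j₀, hs => by
      obtain ⟨-, -, hc'⟩ := hc
      cases hs with
      | renew _ _ hs' => exact leafStep_of_corr P G hc' b j₀ hs'
  | .renew _ _, Gen.born _ _, hc, _, _, _ => hc.elim
  | .renew _ _, Gen.merge _ _ _, hc, _, _, _ => hc.elim
  | .join A B sj, Gen.merge X Y e, hc, b, j₀, hs => by
      obtain ⟨-, hcX, hcY⟩ := hc
      cases hs with
      | left _ _ hs' => exact leafStep_of_corr A X hcX b j₀ hs'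
      | right _ _ hs' => exact leafStep_of_corr B Y hcY b j₀ hs'
  | .join _ _ _, Gen.born _ _, hc, _, _, _ => hc.elim
  | .join _ _ _, Gen.renew _ _ _, hc, _, _, _ => hc.elim

/-- **EVENT STEPS ARE AT MOST THE LAST STEP** of a realised corresponding history. [folklore] -/
theorem events_step_le_of_corr {L : ℕ} {s R : ℕ → ℕ} :
    ∀ (P : PGen (Pt d × Finset (Pt d))) (G : Gen ε) (Z : Finset (Pt d)), Corr sh pay G P → Realises L s R P Z →
      ∀ e ∈ G.events, (sh e).step ≤ P.lastStep
  | .birth j cls zZ, Gen.born b' j', Z, hc, _, e, he => by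
      obtain ⟨hjj, hsh, -⟩ := hc
      rw [Gen.events_born, mem_singleton] at he
      subst he
      simp [hsh, PGen.lastStep]
  | .birth _ _ _, Gen.renew _ _ _, _, hc, _, _, _ => hc.elim
  | .birth _ _ _, Gen.merge _ _ _, _, hc, _, _, _ => hc.elim
  | .renew P h, Gen.renew G e h', Z, hc, hR, x, hx => by
      obtain ⟨-, hsh, hc'⟩ := hc
      obtain ⟨ZG, hG, hst, -, -⟩ := hR
      have hpos := hst.pos
      rw [Gen.events_renew, mem_insert] at hx
      rcases hx with rfl | hx
      · simp [hsh, PGen.lastStep]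
      · have := events_step_le_of_corr P G ZG hc' hG x hx
        simp only [PGen.lastStep]
        omega
  | .renew _ _, Gen.born _ _, _, hc, _, _, _ => hc.elim
  | .renew _ _, Gen.merge _ _ _, _, hc, _, _, _ => hc.elim
  | .join A B sj, Gen.merge X Y e, Z, hc, hR, x, hx => by
      obtain ⟨hsh, hcX, hcY⟩ := hc
      obtain ⟨ZA, ZB, hA, hB, htA, htB, -, -, -, -⟩ := hR
      rw [Gen.events_merge, mem_insert, mem_union] at hx
      rcases hx with rfl | hx | hx
      · simp [hsh, PGen.lastStep]
      · exact (events_step_le_of_corr A X ZA hcX hA x hx).trans htA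
      · exact (events_step_le_of_corr B Y ZB hcY hB x hx).trans htB
  | .join _ _ _, Gen.born _ _, _, hc, _, _, _ => hc.elim
  | .join _ _ _, Gen.renew _ _ _, _, hc, _, _, _ => hc.elim

/-! ## §2 The reduced orbit of a realised sub-history lies in its levelled `31`-zone -/

/-- the zone of a bare birth dated `≤ t` [folklore] -/
theorem regZoneD_born (n L K : ℕ) (lv : ℕ → ℕ) (c : ℕ) (reg : ε → Finset (Fin d → ℕ)) {b : ε} {t : ℕ} (j : ℕ)
    (hbt : (sh b).step ≤ t) :
    regZoneD sh n L K lv c reg t (Gen.born b j) =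
      thickT (n * L ^ (K - lv t)) c (blocks (L ^ (lv t - lv (sh b).step)) (reg b)) := by
  simp [regZoneD, coreZoneD, hbt]

/-! ## §2b Helpers: ranges and collars -/

/-- the core zone of the reduced regions is in range of its level (births dated `≤ t` only) [folklore] -/
theorem inRange_coreZoneD_regR {n L K : ℕ} (hn : 0 < n) (hLpos : 0 < L) {lv : ℕ → ℕ} (hlv : LevelFn K lv) (t : ℕ)
    (X : Gen ε) : InRange (n * L ^ (K - lv t)) (coreZoneD sh L lv (regR sh pay n L K lv) t X) := by
  intro u hu
  obtain ⟨b, -, hbt, hu⟩ := mem_coreZoneD.1 hu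
  have hr : InRange (n * L ^ (K - lv (sh b).step)) (regR sh pay n L K lv b) :=
    inRange_redZone (Nat.mul_pos hn (pow_pos hLpos _)) _
  have hmono : lv (sh b).step ≤ lv t := hlv.monotone hbt
  have hle : n * L ^ (K - lv (sh b).step) ≤ n * L ^ (K - lv t) * L ^ (lv t - lv (sh b).step) := by
    rw [mul_assoc, ← pow_add]
    exact Nat.mul_le_mul_left _ (Nat.pow_le_pow_right hLpos (by omega))
  exact inRange_blocks (Nat.one_le_pow _ _ hLpos) (inRange_mono hle hr) u hu

/-- one more unit of collar: a cell within `1` of a cell of the `c`-thickening lies in the `(c+1)`-thickening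
[folklore] -/
theorem mem_thickT_succ_of_cdist_le_one {m c : ℕ} {S : Finset (Fin d → ℕ)} (hS : InRange m S) {u w : Fin d → ℕ}
    (hu : ∀ i, u i < m) (hw : w ∈ thickT m c S) (huw : cdist m u w ≤ 1) : u ∈ thickT m (c + 1) S := by
  obtain ⟨hwr, v, hv, hwv⟩ := mem_thickT.1 hw
  refine mem_thickT.2 ⟨hu, v, hv, ?_⟩
  calc cdist m u v ≤ cdist m u w + cdist m w v := cdist_triangle hu hwr (hS v hv)
    _ ≤ 1 + c := Nat.add_le_add huw hwv
    _ = c + 1 := Nat.add_comm _ _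

section Walk

variable {L : ℕ} (hL : 3 ≤ L) {n : ℕ} (hn : 0 < n) {s : ℕ → ℕ} (hs : ∀ t, s (t + 1) ≤ s t)
  (hdrop : ∀ m, DropCtl s m) {R : ℕ → ℕ} {K : ℕ}
include hL hn hs hdrop

/-- **THE REDUCED ORBIT OF A REALISED SUB-HISTORY LIES IN ITS LEVELLED `31`-ZONE.**  For `Corr G P`,
`Realises L s R P Z` and `P.lastStep ≤ t ≤ K` (with `lv := levelOf s K`):
`redZone (n·L^{K − lv t}) (orbit L s P.lastStep Z (t − P.lastStep)) ⊆ regZoneD sh n L K lv 31 regR t G`. [folklore] -/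
theorem redZone_orbit_subset_regZoneD :
    ∀ (P : PGen (Pt d × Finset (Pt d))) (G : Gen ε) (Z : Finset (Pt d)) (t : ℕ), Corr sh pay G P →
      Realises L s R P Z → P.lastStep ≤ t → t ≤ K →
      redZone (n * L ^ (K - levelOf s K t)) (orbit L s P.lastStep Z (t - P.lastStep)) ⊆
        regZoneD sh n L K (levelOf s K) 31 (regR sh pay n L K (levelOf s K)) t G
  | .birth j cls zZ, Gen.born b' j', Z, t, hc, hR, hjt, htK => by
      obtain ⟨hjj, hsh, hpay⟩ := hc
      obtain ⟨hZ, -, -, -⟩ := hR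
      have hstep : (sh b').step = j := by rw [hsh]; rfl
      simp only [PGen.lastStep] at hjt ⊢
      rw [regZoneD_born n L K (levelOf s K) 31 _ j' (by rw [hstep]; exact hjt), hstep]
      have hreg : regR sh pay n L K (levelOf s K) b' = redZone (n * L ^ (K - levelOf s K j)) Z := by
        rw [regR, hpay, hZ, hstep]
      rw [hreg]
      exact redZone_orbit_subset hL hn hs hdrop hjt htK Z
  | .birth _ _ _, Gen.renew _ _ _, _, _, hc, _, _, _ => hc.elim
  | .birth _ _ _, Gen.merge _ _ _, _, _, hc, _, _, _ => hc.elim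
  | .renew P h, Gen.renew G e h', Z, t, hc, hR, hht, htK => by
      obtain ⟨-, -, hc'⟩ := hc
      obtain ⟨ZG, hG, hst, -, hZ⟩ := hR
      have hpos := hst.pos
      simp only [PGen.lastStep] at hht ⊢
      have hP : P.lastStep ≤ h + 1 := by omega
      have horb : orbit L s (h + 1) Z (t - (h + 1)) = orbit L s P.lastStep ZG (t - P.lastStep) := by
        have e := orbit_add L s P.lastStep ZG (h + 1 - P.lastStep) (t - (h + 1))
        rw [show P.lastStep + (h + 1 - P.lastStep) = h + 1 by omega,
          show h + 1 - P.lastStep + (t - (h + 1)) = t - P.lastStep by omega] at e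
        rw [hZ]
        exact e.symm
      rw [horb, regZoneD_renew]
      exact redZone_orbit_subset_regZoneD P G ZG t hc' hG (by omega) htK
  | .renew _ _, Gen.born _ _, _, _, hc, _, _, _ => hc.elim
  | .renew _ _, Gen.merge _ _ _, _, _, hc, _, _, _ => hc.elim
  | .join A B sj, Gen.merge X Y e, Z, t, hc, hR, hst, htK => by
      obtain ⟨-, hcX, hcY⟩ := hc
      obtain ⟨ZA, ZB, hA, hB, htA, htB, -, -, -, hZ⟩ := hR
      simp only [PGen.lastStep] at hst ⊢
      have hA' : orbit L s sj (orbit L s A.lastStep ZA (sj - A.lastStep)) (t - sj) =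
          orbit L s A.lastStep ZA (t - A.lastStep) := by
        have e := orbit_add L s A.lastStep ZA (sj - A.lastStep) (t - sj)
        rw [show A.lastStep + (sj - A.lastStep) = sj by omega,
          show sj - A.lastStep + (t - sj) = t - A.lastStep by omega] at e
        exact e.symm
      have hB' : orbit L s sj (orbit L s B.lastStep ZB (sj - B.lastStep)) (t - sj) =
          orbit L s B.lastStep ZB (t - B.lastStep) := by
        have e := orbit_add L s B.lastStep ZB (sj - B.lastStep) (t - sj)
        rw [show B.lastStep + (sj - B.lastStep) = sj by omega,
          show sj - B.lastStep + (t - sj) = t - B.lastStep by omega] at e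
        exact e.symm
      have hunion : ∀ (X₁ X₂ : Finset (Pt d)) (l : ℕ),
          orbit L s sj (X₁ ∪ X₂) l = orbit L s sj X₁ l ∪ orbit L s sj X₂ l := fun X₁ X₂ l => Siter_union _ _ _ _
      have hsub : orbit L s sj Z (t - sj) ⊆
          orbit L s A.lastStep ZA (t - A.lastStep) ∪ orbit L s B.lastStep ZB (t - B.lastStep) := by
        have h1 : orbit L s sj Z (t - sj) ⊆
            orbit L s sj (orbit L s A.lastStep ZA (sj - A.lastStep) ∪ orbit L s B.lastStep ZB (sj - B.lastStep))
              (t - sj) := SpaceTimePeierls.Siter_mono _ hZ _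
        rw [hunion, hA', hB'] at h1
        exact h1
      intro u hu
      have hu' := redZone_mono _ hsub hu
      rw [redZone_union, mem_union] at hu'
      rw [regZoneD_merge, mem_union]
      rcases hu' with hu' | hu'
      · exact Or.inl (redZone_orbit_subset_regZoneD A X ZA t hcX hA (htA.trans hst) htK hu')
      · exact Or.inr (redZone_orbit_subset_regZoneD B Y ZB t hcY hB (htB.trans hst) htK hu')
  | .join _ _ _, Gen.born _ _, _, _, hc, _, _, _ => hc.elim
  | .join _ _ _, Gen.renew _ _ _, _, _, hc, _, _, _ => hc.elim

/-! ## §3 Contact at every merge node -/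

/-- **CONTACT AT EVERY MERGE NODE OF A REALISED CORRESPONDING HISTORY**: the partners' levelled `32`-zones share a
cell at the merger's shape-step (the reduced touching cube of the older partner's S-image). [folklore] -/
theorem contact_of_corr :
    ∀ (P : PGen (Pt d × Finset (Pt d))) (G : Gen ε) (Z : Finset (Pt d)), Corr sh pay G P → Realises L s R P Z →
      P.lastStep ≤ K → ∀ (X Y : Gen ε) (e : ε), Sub (Gen.merge X Y e) G →
        ∃ z, z ∈ regZoneD sh n L K (levelOf s K) 32 (regR sh pay n L K (levelOf s K)) (sh e).step X ∧
          z ∈ regZoneD sh n L K (levelOf s K) 32 (regR sh pay n L K (levelOf s K)) (sh e).step Y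
  | .birth j cls zZ, Gen.born b' j', Z, _, _, _, X, Y, e, hsub => by cases hsub
  | .birth _ _ _, Gen.renew _ _ _, _, hc, _, _, _, _, _, _ => hc.elim
  | .birth _ _ _, Gen.merge _ _ _, _, hc, _, _, _, _, _, _ => hc.elim
  | .renew P h, Gen.renew G e' h', Z, hc, hR, hK, X, Y, e, hsub => by
      obtain ⟨-, -, hc'⟩ := hc
      obtain ⟨ZG, hG, hst, -, -⟩ := hR
      have hpos := hst.pos
      simp only [PGen.lastStep] at hK
      cases hsub with
      | renew _ _ hs' => exact contact_of_corr P G ZG hc' hG (by omega) X Y e hs'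
  | .renew _ _, Gen.born _ _, _, hc, _, _, _, _, _, _ => hc.elim
  | .renew _ _, Gen.merge _ _ _, _, hc, _, _, _, _, _, _ => hc.elim
  | .join A B sj, Gen.merge X' Y' e', Z, hc, hR, hK, X, Y, e, hsub => by
      obtain ⟨hsh, hcX, hcY⟩ := hc
      obtain ⟨ZA, ZB, hA, hB, htA, htB, -, -, ⟨a, ha, c, hcm, hac⟩, -⟩ := hR
      simp only [PGen.lastStep] at hK
      cases hsub with
      | refl =>
          -- the node itself: the reduced touching cube `a` of the older partner's S-image
          have hL0 : 0 < L := by omega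
          have hsK : ∀ u, u < K → s (u + 1) ≤ s u := fun u _ => hs u
          have hLF := levelFn_levelOf hsK (hdrop K)
          have hstep : (sh e').step = sj := by rw [hsh]; rfl
          set m := n * L ^ (K - levelOf s K sj) with hm
          have hm0 : 0 < m := Nat.mul_pos hn (pow_pos hL0 _)
          set u : Fin d → ℕ := fun i => res m (a i) with hu
          set w : Fin d → ℕ := fun i => res m (c i) with hw
          have hua : u ∈ redZone m (orbit L s A.lastStep ZA (sj - A.lastStep)) := mem_image.2 ⟨a, ha, rfl⟩
          have hwc : w ∈ redZone m (orbit L s B.lastStep ZB (sj - B.lastStep)) := mem_image.2 ⟨c, hcm, rfl⟩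
          have hA31 := redZone_orbit_subset_regZoneD hL hn hs hdrop A X' ZA sj hcX hA htA hK hua
          have hB31 := redZone_orbit_subset_regZoneD hL hn hs hdrop B Y' ZB sj hcY hB htB hK hwc
          have huw : cdist m u w ≤ 1 := cdist_red_le hm0 a c 1 fun i => by
            obtain ⟨h1, h2⟩ := hac i
            omega
          refine ⟨u, ?_, ?_⟩
          · rw [hstep]
            exact HistoryZoneMass.thickT_mono_radius m (by norm_num) _ hA31
          · rw [hstep]
            exact mem_thickT_succ_of_cdist_le_one (inRange_coreZoneD_regR hn hL0 hLF sj Y')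
              (fun i => res_lt hm0 (a i)) hB31 huw
      | left _ _ hs' => exact contact_of_corr A X' ZA hcX hA (htA.trans hK) X Y e hs'
      | right _ _ hs' => exact contact_of_corr B Y' ZB hcY hB (htB.trans hK) X Y e hs'
  | .join _ _ _, Gen.born _ _, _, hc, _, _, _, _, _, _ => hc.elim
  | .join _ _ _, Gen.renew _ _ _, _, hc, _, _, _, _, _, _ => hc.elim

/-! ## §3b The birth-region laws at levels -/

/-- **A REALISED CORRESPONDING HISTORY INHABITS THE LEVELLED BIRTH-REGION LAWS** (`Cb = 4·2^d`, collar `32`,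
`lv := levelOf s K`). [folklore] -/
theorem birthRegionsD_of_corr {P : PGen (Pt d × Finset (Pt d))} {G : Gen ε} {Z : Finset (Pt d)}
    (hc : Corr sh pay G P) (hR : Realises L s R P Z) (hK : P.lastStep ≤ K) :
    BirthRegionsD sh n L K (levelOf s K) (4 * 2 ^ d) 32 G (regR sh pay n L K (levelOf s K)) :=
  birthRegionsD_of_faceConnected sh (Nat.one_le_iff_ne_zero.2 (Nat.pos_iff_ne_zero.1 hn)) (by omega) (levelOf s K) 32
    (fun b => (pay b).2) (fun b hb => ⟨_, (births_facts_of_corr P G Z hc hR b hb).2.1⟩)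
    (fun b hb => (births_facts_of_corr P G Z hc hR b hb).2.2.1)
    (fun b hb => (births_facts_of_corr P G Z hc hR b hb).2.2.2)
    (fun b hb => (births_facts_of_corr P G Z hc hR b hb).1)
    (contact_of_corr hL hn hs hdrop P G Z hc hR hK)

end Walk

/-! ## §4 Sanity (decided) -/

namespace SanityZOR

/-- a two-leaf tagged join and its census history correspond: births `(0,0,1)`∕`(0,0,0)` at step `0` with payloads
(anchor, region), joined at step `1` by the label `(1,2,0)` -/
example : Corr (ε := PEv × ℕ) Prod.fst
    (fun ℓ => if ℓ.2 = 7 then (![0], {![0], ![1]}) else (![3], {![3]}))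
    (Gen.merge (Gen.born (((0, 0, 1) : PEv), 7) 0) (Gen.born (((0, 0, 0) : PEv), 8) 0) (((1, 2, 0) : PEv), 9))
    (PGen.join (PGen.birth 0 1 (![0], {![0], ![1]})) (PGen.birth 0 0 (![3], {![3]})) 1) := by
  simp [Corr]

end SanityZOR

end

end Summit.QuantumFields.BalabanUV.T4Continuum.HistoryZones
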